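import Summits.BirchSwinnertonDyer.BirchSwinnertonDyer.Theorems.TwoAdicConverseBDPAcLineSpecialisationAtTwoAlgebra
import Summits.BirchSwinnertonDyer.BirchSwinnertonDyer.Theorems.TwoAdicConverseBDPAcLineSpecialisationAtTwoControl
import Summits.BirchSwinnertonDyer.BirchSwinnertonDyer.Theorems.TwoAdicConverseBDPAcControlAtTwo
import Summits.BirchSwinnertonDyer.BirchSwinnertonDyer.Theorems.TwoAdicConverseBDPSelmerLowerDivisibilityAtTwoAcPinNecessary
import HarnessLib

/-!
# AC-LINE SPECIALISATION₂, part (B): the AC-LINE BUDGET at rank-one data — `(toUnr₂ J C₀)(0,0) ∣ p^k · J(𝓕(0)) ≠ 0` —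
# NONDEG₀ of the two-variable Selmer characteristic series on the anticyclotomic line, and the (e15) inequality at `2`
# «pinning needs Selmer budget at the origin», `1 + a ≤ k + m` (crux `BDPSelmerLowerDivisibilityAtTwo`, stmt-24728; S3)

Helper file `--supports stmt-BirchSwinnertonDyer-24728` (cell `bsd-2adic`, seat `bsd-2adic-tower-1` GEN 53; key
«AC-LINE SPECIALISATION₂» (S2), director-bsd (642)(1), pen SUMMON 20260830T184646Z). THEOREMS ONLY (0 def / fact / instance /
`sorry`). COMPOSITE of part (A) (`charIdeal_XAc_map_le_rat'`, the `hK`-free specialisation), LINK A₂ (tower-1 GEN 52,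
`TwoAdicBDPAcControl.hasCharValuationAt_of_rankOne`: `𝔛_ac` torsion, `char_Λ 𝔛_ac = (𝓕)`, `𝓕(0) ≠ 0`, `ord_p 𝓕(0) = m`) and
part (C) (`acLineControl_of_localExponent`: the control input `hctl` from the local finite exponent `hfixc`), ANY prime `p`:
* §1 `acLineBudget_of_hasCharValuationAt` (any `E` over a number field, `m`-currency): `∃ k F, ch(𝔛_ac) = (F) ∧ F(0) ≠ 0 ∧
  ord_p F(0) = m ∧ C(p^k)·F^J ∈ π(ch_{Λ_K}(X_Gr₂)·Λ^ur)`; `acLineBudget_of_rankOne` (LINK A₂'s binders + `hctl`);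
  `acLineBudget_of_rankOne_of_localExponent` (the NET SHAPE: the door at rank-one data ⟸ ONE typed LOCAL hypothesis `hfixc`).
* §2 PRINCIPAL CASE `ch_{Λ_K}(X_Gr₂) = (C₀)` (the O2 line's currency): `structureMap_apply_ne_zero` (`J : ℤ_p → 𝒪_{ℂ_p}` kills
  nothing non-zero, no compatibility binder); ★ `constantCoeff_toUnr₂_dvd_of_hasCharValuationAt` — BUDGET `π(J C₀) ∣ C(p^k)·F^J`
  in `𝒪⟦T⟧` and `(J C₀)(0,0) ∣ p^k·J(F(0))` in `𝒪_{ℂ_p}`; ★ `constantCoeff_toUnr₂_ne_zero_of_hasCharValuationAt` — NONDEG₀(ℓ_ac):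
  `π(J C₀) ≠ 0` (the restriction of the two-variable Selmer characteristic series to the ac line `T₁ = 0` is NON-ZERO) and
  `(J C₀)(0,0) ≠ 0`; unit form `(J C₀)(0,0) ∣ p^{k+m}·u`; rank-one form from `hfixc`.
* §3 (e15), `p = 2`: `lt_of_pow_mul_dvd_pow_mul`; ★ `lt_budget_of_fibrePinned`: `FibrePinned G (toUnr₂ 2 J C₀)` (the O2 line's
  ACPIN datum, UNFOLDED as in ACPIN-NEC p781951) ∧ `G(0,0) ∈ 𝔪` (W⁺ reading) ∧ `toUnr₂ 2 J C₀ = 2^a·C₁` (`red C₁ ≠ 0`) ∧ BUDGET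
  with exponent `n` ⟹ `a < n`; ★ `one_add_le_of_fibrePinned_of_hasCharValuationAt` / `…_of_rankOne_of_localExponent`: door
  exponent `k`, LINK A₂ exponent `m`: `(J C₀)(0,0) ∣ 2^{k+m}·u` and `1 + a ≤ k + m` — a pinned W⁺ datum with `k + m = 0` is IMPOSSIBLE.

HONEST LABELS: (S2) is CHARACTERISTIC-ZERO information on the ac restriction — NONDEG₀(ℓ_ac) + BUDGET. It is NOT LinePin's
residual NONDEG(ℓ) `PowerSeries.map (IsLocalRing.residue _) (PowerSeries.constantCoeff C) ≠ 0` (hypothesis `hC` of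
`span_eq_span_of_pow_mul_eq_of_line_dvd`) — the gap is exactly `μ` of the ac restriction (`μ(𝔛_ac) = 0` is NOT given by LINK A₂)
plus the exponent `k`; it is NOT ACPIN's (N) or (Λ) (both residual; (Λ) bounds the algebraic line-`λ` from BELOW, (S2) bounds the
algebraic side from ABOVE along the line); it does NOT touch U / R0G / OV16-print; the count of record of O2 does not move (a door
is not a discharge). BSD is proved for no curve by any of this; typed ≠ proved. References: Jetchev–Skinner–Wan, Camb. J. Math. 5
(2017) §3.4, Thm. 3.3.1; Skinner–Urban, Invent. Math. 195 (2014) Prop. 3.2.8, Cor. 3.2.9; Greenberg, LNM 1716 §4 Lemma 4.2.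
-/


-- D-0017: single-problem summit, the namespace repeats the problem name by design.
set_option linter.dupNamespace false
set_option autoImplicit false

noncomputable section

open scoped Classical

open NumberField IsDedekindDomain Field WeierstrassCurve
open Literature.NumberTheory.EllipticCurves Literature.NumberTheory.EllipticCurves.GreenbergSelmer
  Literature.NumberTheory.EllipticCurves.GreenbergVatsal2000 Literature.NumberTheory.EllipticCurves.Castella2018
  Literature.NumberTheory.EllipticCurves.TwoVariableSelmer Literature.NumberTheory.EllipticCurves.Rank1Residual
open Summit.BirchSwinnertonDyer.Rank1Residual
open Summit.BirchSwinnertonDyer.BirchSwinnertonDyer.Theorems.TwoAdicBDPAcControl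
open Summit.BirchSwinnertonDyer.BirchSwinnertonDyer.Theorems.TwoAdicBDPAcPinNecessary

namespace Summit.BirchSwinnertonDyer.BirchSwinnertonDyer.Theorems.TwoAdicBDPAcLineSpec

/-! ## §1. The composite «AC-LINE BUDGET»: `∃ k F, ch(𝔛_ac) = (F) ∧ F(0) ≠ 0 ∧ C(p^k)·F^J ∈ π(ch_{Λ_K}(X_Gr₂)·Λ^ur)` -/

section Composite

variable {K : Type} [Field K] [NumberField K] (E : WeierstrassCurve K) [E.IsElliptic] (p : ℕ) [Fact p.Prime]
  (κ₁ κ₂ : ZpExtension K p) (vbar : HeightOneSpectrum (𝓞 K)) (γ₁ γ₂ : absoluteGaloisGroup K)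
  [Fact (ZpExtension.IsTopGeneratorPair κ₁ κ₂ γ₁ γ₂)] [Fact (κ₂.IsTopGenerator γ₂)]

/-- ★ **AC-LINE BUDGET in the `m`-currency** (any `E` elliptic over a number field `K`, ANY `p`, any generator pair with
`κ₂` in the second slot, any `v̄`). If `𝔛_ac = AcSelmer.XAc E p κ₂ v̄ ∅ γ₂` has a characteristic generator with
`ord_p 𝓕(0) = m` (`HasCharValuationAt … m`: torsion ∧ `ch = (𝓕)` ∧ `𝓕(0) ≠ 0` ∧ valuation `m`) and control holds with
exponent (`hctl`), then for every structure map `J : ℤ_p → 𝒪_{ℂ_p}` there are `k` and `F` with `ch(𝔛_ac) = (F)`,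
`F(0) ≠ 0`, `ord_p F(0) = m` and `C(p^k) · F^J ∈ π(ch_{Λ_K}(X_Gr₂)·Λ^ur)`, `π : T₁ ↦ 0` (part (A)
`charIdeal_XAc_map_le_rat'`, no `E(K)[p] = 0`). [cite: JetchevSkinnerWan2017, §3.4 (arXiv:1512.06894 pp. 14–15)]
[cite: GreenbergLNM1716, §4 Lemma 4.2] [cite: Castella2018, Thm. 2.3 (arXiv:1704.06608 p. 5) (shape)] -/
theorem acLineBudget_of_hasCharValuationAt {m : ℕ}
    (hval : AcSelmer.XAc.HasCharValuationAt E p κ₂ vbar ∅ γ₂ m)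
    (hctl : ∃ n : ℕ, ∀ s : unrSelmer₂ κ₁ κ₂ (E.geomPrimaryTorsion p) vbar,
      conjSel₂ κ₁ κ₂ (E.geomPrimaryTorsion p) vbar γ₁ s = s →
        p ^ n • s ∈ Set.range (E.selmerAcToUnrSelmer₂ p κ₁ κ₂ vbar))
    (J : ℤ_[p] →+* PadicComplexInt p) :
    ∃ (k : ℕ) (F : IwasawaAlgebra p),
      AcSelmer.XAc.charIdeal E p κ₂ vbar ∅ γ₂ = Ideal.span {F} ∧ PowerSeries.constantCoeff F ≠ 0 ∧
      (PowerSeries.constantCoeff F).valuation = m ∧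
      PowerSeries.C (((p : ℕ) : PadicComplexInt p) ^ k) * PowerSeries.map J F ∈
        ((XGr₂.charIdeal E p κ₁ κ₂ vbar γ₁ γ₂).map (IwasawaAlgebra₂.toUnr₂ p J)).map
          (PowerSeries.constantCoeff (R := PowerSeries (PadicComplexInt p))) := by
  obtain ⟨hYt, F, hF, hF0, hFm⟩ := hval
  obtain ⟨k, hk⟩ := charIdeal_XAc_map_le_rat' E p κ₁ κ₂ vbar γ₁ γ₂ hYt hctl J
  refine ⟨k, F, hF, hF0, hFm, hk _ ?_⟩
  rw [hF, Ideal.map_span, Set.image_singleton]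
  exact Ideal.mem_span_singleton_self _

end Composite

section RankOne

variable (W : WeierstrassCurve ℚ) [W.IsElliptic] [W.IsGloballyMinimal] (p : ℕ) [Fact p.Prime]
  {K : Type} [Field K] [NumberField K]

/-- ★ **AC-LINE BUDGET AT RANK-ONE DATA, ANY PRIME** (`p = 2` is the instance the ladder reads): LINK A₂'s binders
(`W/ℚ` elliptic globally minimal, `K` imaginary quadratic with `p` split, a generator pair `(κ₁, κ₂; γ₁, γ₂)` with `κ₂`
ANTICYCLOTOMIC, `v̄ ∋ p`, `rank E(K) = 1`, `#Ш(E/K)[p^∞] < ∞`) + control with exponent `hctl` at `(W_K, p, κ₁, κ₂, v̄, γ₁)`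
VERBATIM + `J` ⟹ `∃ k F, ch(𝔛_ac) = (F) ∧ F(0) ≠ 0 ∧ C(p^k)·F^J ∈ π(ch_{Λ_K}(X_Gr₂(E_K/K̃_∞))·Λ^ur)`
(= `TwoAdicBDPAcControl.hasCharValuationAt_of_rankOne` + §1). [cite: JetchevSkinnerWan2017, Thm. 3.3.1 (shape) and §3.4]
[cite: GreenbergLNM1716, §4 Lemma 4.2] -/
theorem acLineBudget_of_rankOne (hK : IsImaginaryQuadratic K) (hsplit : X11b.SplitsIn K p)
    (κ₁ κ₂ : ZpExtension K p) (γ₁ γ₂ : absoluteGaloisGroup K) [Fact (ZpExtension.IsTopGeneratorPair κ₁ κ₂ γ₁ γ₂)]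
    [Fact (κ₂.IsTopGenerator γ₂)] (hκ₂ : κ₂.IsAnticyclotomic)
    (vbar : HeightOneSpectrum (𝓞 K)) (hvbar : ((p : ℕ) : 𝓞 K) ∈ vbar.asIdeal)
    (hrank : (W.baseChange K).mordellWeilRank = 1)
    (hsha : Finite (AddCommGroup.primaryComponent (W.baseChange K).sha p))
    (hctl : ∃ n : ℕ, ∀ s : unrSelmer₂ κ₁ κ₂ ((W.baseChange K).geomPrimaryTorsion p) vbar,
      conjSel₂ κ₁ κ₂ ((W.baseChange K).geomPrimaryTorsion p) vbar γ₁ s = s →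
        p ^ n • s ∈ Set.range ((W.baseChange K).selmerAcToUnrSelmer₂ p κ₁ κ₂ vbar))
    (J : ℤ_[p] →+* PadicComplexInt p) :
    ∃ (k : ℕ) (F : IwasawaAlgebra p),
      AcSelmer.XAc.charIdeal (W.baseChange K) p κ₂ vbar ∅ γ₂ = Ideal.span {F} ∧ PowerSeries.constantCoeff F ≠ 0 ∧
      PowerSeries.C (((p : ℕ) : PadicComplexInt p) ^ k) * PowerSeries.map J F ∈
        ((XGr₂.charIdeal (W.baseChange K) p κ₁ κ₂ vbar γ₁ γ₂).map (IwasawaAlgebra₂.toUnr₂ p J)).map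
          (PowerSeries.constantCoeff (R := PowerSeries (PadicComplexInt p))) := by
  haveI : (W.baseChange K).IsElliptic := by rw [baseChange]; infer_instance
  obtain ⟨m, hm⟩ := hasCharValuationAt_of_rankOne W p hK hsplit κ₂ hκ₂ γ₂ vbar hvbar hrank hsha
  obtain ⟨k, F, hF, hF0, -, hk⟩ := acLineBudget_of_hasCharValuationAt (W.baseChange K) p κ₁ κ₂ vbar γ₁ γ₂ hm hctl J
  exact ⟨k, F, hF, hF0, hk⟩

/-- ★ **THE NET SHAPE — the door at rank-one data from ONE typed LOCAL hypothesis**: as `acLineBudget_of_rankOne` with the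
control input `hctl` REPLACED by the local finite exponent `hfixc` («`E_K[p^∞]^{Gal(K̄/K̃_∞) ∩ I_{v̄}}` killed by `p^c`»,
part (C) `acLineControl_of_localExponent` — GLOBAL and AWAY steps kernel, `v̄` step in exponent form).
[cite: JetchevSkinnerWan2017, Thm. 3.3.1 (shape) and §3.4] [cite: SkinnerUrban2014, Prop. 3.2.8 (p. 23)] -/
theorem acLineBudget_of_rankOne_of_localExponent (hK : IsImaginaryQuadratic K) (hsplit : X11b.SplitsIn K p)
    (κ₁ κ₂ : ZpExtension K p) (γ₁ γ₂ : absoluteGaloisGroup K) [Fact (ZpExtension.IsTopGeneratorPair κ₁ κ₂ γ₁ γ₂)]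
    [Fact (κ₂.IsTopGenerator γ₂)] (hκ₂ : κ₂.IsAnticyclotomic)
    (vbar : HeightOneSpectrum (𝓞 K)) (hvbar : ((p : ℕ) : 𝓞 K) ∈ vbar.asIdeal)
    (hrank : (W.baseChange K).mordellWeilRank = 1)
    (hsha : Finite (AddCommGroup.primaryComponent (W.baseChange K).sha p))
    (hfixc : ∃ c : ℕ, ∀ m : (W.baseChange K).geomPrimaryTorsion p, (∀ x : absoluteGaloisGroup K,
      x ∈ ZpExtension.pairKer κ₁ κ₂ → x ∈ inertia vbar → x • m = m) → p ^ c • m = 0)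
    (J : ℤ_[p] →+* PadicComplexInt p) :
    ∃ (k : ℕ) (F : IwasawaAlgebra p),
      AcSelmer.XAc.charIdeal (W.baseChange K) p κ₂ vbar ∅ γ₂ = Ideal.span {F} ∧ PowerSeries.constantCoeff F ≠ 0 ∧
      PowerSeries.C (((p : ℕ) : PadicComplexInt p) ^ k) * PowerSeries.map J F ∈
        ((XGr₂.charIdeal (W.baseChange K) p κ₁ κ₂ vbar γ₁ γ₂).map (IwasawaAlgebra₂.toUnr₂ p J)).map
          (PowerSeries.constantCoeff (R := PowerSeries (PadicComplexInt p))) :=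
  acLineBudget_of_rankOne W p hK hsplit κ₁ κ₂ γ₁ γ₂ hκ₂ vbar hvbar hrank hsha
    (acLineControl_of_localExponent W p K hK κ₁ κ₂ γ₁ γ₂ vbar hvbar hfixc) J

end RankOne

/-! ## §2. Principal case `ch_{Λ_K}(X_Gr₂) = (C₀)`: the BUDGET divisibility `(J C₀)(0,0) ∣ p^k · J(F(0))` and NONDEG₀(ℓ_ac) -/

section Principal

variable {p : ℕ} [Fact p.Prime]

/-- **A structure map `J : ℤ_p → 𝒪_{ℂ_p}` kills no non-zero element** (no compatibility binder needed): `x = u · p^n`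
with `u ∈ ℤ_pˣ` (`PadicInt.unitCoeff_spec`), so `J x = J(u) · p^n ≠ 0` in the characteristic-zero domain `𝒪_{ℂ_p}`. [folklore] -/
theorem structureMap_apply_ne_zero (J : ℤ_[p] →+* PadicComplexInt p) {x : ℤ_[p]} (hx : x ≠ 0) : J x ≠ 0 := by
  have hp : p.Prime := Fact.out
  rw [PadicInt.unitCoeff_spec hx, map_mul, map_pow, map_natCast]
  exact mul_ne_zero ((PadicInt.unitCoeff hx).isUnit.map J).ne_zero
    (pow_ne_zero _ (Nat.cast_ne_zero.mpr hp.ne_zero))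

/-- Reading a membership in `π((C₀)·Λ^ur)` as a divisibility: `y ∈ ((span {C₀}).map toUnr₂).map π ↔ π(J C₀) ∣ y`. [folklore] -/
theorem mem_map_map_span_singleton_iff (J : ℤ_[p] →+* PadicComplexInt p) (C₀ : IwasawaAlgebra₂ p)
    (y : PowerSeries (PadicComplexInt p)) :
    y ∈ ((Ideal.span {C₀}).map (IwasawaAlgebra₂.toUnr₂ p J)).map
        (PowerSeries.constantCoeff (R := PowerSeries (PadicComplexInt p))) ↔
      PowerSeries.constantCoeff (IwasawaAlgebra₂.toUnr₂ p J C₀) ∣ y := by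
  rw [Ideal.map_span, Set.image_singleton, Ideal.map_span, Set.image_singleton, Ideal.mem_span_singleton]

end Principal

section PrincipalCurve

variable {K : Type} [Field K] [NumberField K] (E : WeierstrassCurve K) [E.IsElliptic] (p : ℕ) [Fact p.Prime]
  (κ₁ κ₂ : ZpExtension K p) (vbar : HeightOneSpectrum (𝓞 K)) (γ₁ γ₂ : absoluteGaloisGroup K)
  [Fact (ZpExtension.IsTopGeneratorPair κ₁ κ₂ γ₁ γ₂)] [Fact (κ₂.IsTopGenerator γ₂)]

/-- ★ **BUDGET (principal case).** If `ch_{Λ_K}(X_Gr₂) = (C₀)`, `𝔛_ac` has `HasCharValuationAt … m` and control holds with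
exponent, then for every `J` there are `k` and a generator `F` of `ch(𝔛_ac)` (`F(0) ≠ 0`, `ord_p F(0) = m`) with
(i) `π(J C₀) ∣ C(p^k) · F^J` in `𝒪_{ℂ_p}⟦T⟧` — the restriction of the two-variable Selmer characteristic series to the
anticyclotomic line `T₁ = 0` DIVIDES `p^k` times the one-variable series — and (ii) AT THE ORIGIN
`(J C₀)(0,0) ∣ p^k · J(F(0))` in `𝒪_{ℂ_p}`, i.e. `v((J C₀)(0,0)) ≤ k + ord_p F(0) = k + m`.
[cite: JetchevSkinnerWan2017, §3.4 Cor. "bigSelmercontrol" (arXiv:1512.06894 p. 15)] [cite: SkinnerUrban2014, Cor. 3.2.9 (p. 24)] -/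
theorem constantCoeff_toUnr₂_dvd_of_hasCharValuationAt {m : ℕ}
    (hval : AcSelmer.XAc.HasCharValuationAt E p κ₂ vbar ∅ γ₂ m)
    (hctl : ∃ n : ℕ, ∀ s : unrSelmer₂ κ₁ κ₂ (E.geomPrimaryTorsion p) vbar,
      conjSel₂ κ₁ κ₂ (E.geomPrimaryTorsion p) vbar γ₁ s = s →
        p ^ n • s ∈ Set.range (E.selmerAcToUnrSelmer₂ p κ₁ κ₂ vbar))
    (J : ℤ_[p] →+* PadicComplexInt p) (C₀ : IwasawaAlgebra₂ p)
    (hC₀ : XGr₂.charIdeal E p κ₁ κ₂ vbar γ₁ γ₂ = Ideal.span {C₀}) :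
    ∃ (k : ℕ) (F : IwasawaAlgebra p),
      AcSelmer.XAc.charIdeal E p κ₂ vbar ∅ γ₂ = Ideal.span {F} ∧ PowerSeries.constantCoeff F ≠ 0 ∧
      (PowerSeries.constantCoeff F).valuation = m ∧
      PowerSeries.constantCoeff (IwasawaAlgebra₂.toUnr₂ p J C₀) ∣
        PowerSeries.C (((p : ℕ) : PadicComplexInt p) ^ k) * PowerSeries.map J F ∧
      PowerSeries.constantCoeff (PowerSeries.constantCoeff (IwasawaAlgebra₂.toUnr₂ p J C₀)) ∣
        ((p : ℕ) : PadicComplexInt p) ^ k * J (PowerSeries.constantCoeff F) := by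
  obtain ⟨k, F, hF, hF0, hFm, hk⟩ := acLineBudget_of_hasCharValuationAt E p κ₁ κ₂ vbar γ₁ γ₂ hval hctl J
  rw [hC₀, mem_map_map_span_singleton_iff] at hk
  refine ⟨k, F, hF, hF0, hFm, hk, ?_⟩
  have hcm : PowerSeries.constantCoeff (PowerSeries.map J F) = J (PowerSeries.constantCoeff F) := by
    rw [← PowerSeries.coeff_zero_eq_constantCoeff_apply, PowerSeries.coeff_map,
      PowerSeries.coeff_zero_eq_constantCoeff_apply]
  have h := map_dvd (PowerSeries.constantCoeff (R := PadicComplexInt p)) hk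
  rwa [map_mul, PowerSeries.constantCoeff_C, hcm] at h

/-- ★ **NONDEG₀(ℓ_ac) (principal case).** Under the hypotheses of `constantCoeff_toUnr₂_dvd_of_hasCharValuationAt`:
`π(J C₀) ≠ 0` in `𝒪_{ℂ_p}⟦T⟧` — the restriction of the two-variable Selmer characteristic series `C₀` to the anticyclotomic
line `T₁ = 0` is NON-ZERO — and `(J C₀)(0,0) ≠ 0` — it is non-zero AT THE ORIGIN: both divide `p^k · J(F(0)) ≠ 0`
(`structureMap_apply_ne_zero`). CHARACTERISTIC-ZERO information: NOT the residual `red(π C) ≠ 0` of LinePin (the gap is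
`μ` of the ac restriction and the exponent `k`). [cite: JetchevSkinnerWan2017, §3.4 (arXiv:1512.06894 pp. 14–15)]
[cite: GreenbergLNM1716, §4 Lemma 4.2] -/
theorem constantCoeff_toUnr₂_ne_zero_of_hasCharValuationAt {m : ℕ}
    (hval : AcSelmer.XAc.HasCharValuationAt E p κ₂ vbar ∅ γ₂ m)
    (hctl : ∃ n : ℕ, ∀ s : unrSelmer₂ κ₁ κ₂ (E.geomPrimaryTorsion p) vbar,
      conjSel₂ κ₁ κ₂ (E.geomPrimaryTorsion p) vbar γ₁ s = s →
        p ^ n • s ∈ Set.range (E.selmerAcToUnrSelmer₂ p κ₁ κ₂ vbar))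
    (J : ℤ_[p] →+* PadicComplexInt p) (C₀ : IwasawaAlgebra₂ p)
    (hC₀ : XGr₂.charIdeal E p κ₁ κ₂ vbar γ₁ γ₂ = Ideal.span {C₀}) :
    PowerSeries.constantCoeff (IwasawaAlgebra₂.toUnr₂ p J C₀) ≠ 0 ∧
      PowerSeries.constantCoeff (PowerSeries.constantCoeff (IwasawaAlgebra₂.toUnr₂ p J C₀)) ≠ 0 := by
  have hp : p.Prime := Fact.out
  obtain ⟨k, F, -, hF0, -, hk, hk0⟩ :=
    constantCoeff_toUnr₂_dvd_of_hasCharValuationAt E p κ₁ κ₂ vbar γ₁ γ₂ hval hctl J C₀ hC₀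
  have hne : ((p : ℕ) : PadicComplexInt p) ^ k * J (PowerSeries.constantCoeff F) ≠ 0 :=
    mul_ne_zero (pow_ne_zero _ (Nat.cast_ne_zero.mpr hp.ne_zero)) (structureMap_apply_ne_zero J hF0)
  have h0 : PowerSeries.constantCoeff (PowerSeries.constantCoeff (IwasawaAlgebra₂.toUnr₂ p J C₀)) ≠ 0 :=
    ne_zero_of_dvd_ne_zero hne hk0
  refine ⟨fun h => h0 ?_, h0⟩
  rw [h, map_zero]

/-- **BUDGET, unit form**: `(J C₀)(0,0) ∣ p^{k+m} · u` with `u` a unit of `𝒪_{ℂ_p}` (`F(0) = u₀ · p^m`, `u₀ ∈ ℤ_pˣ`,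
`PadicInt.unitCoeff_spec`; `u = J u₀`): `v((J C₀)(0,0)) ≤ k + m`, `m = ord_p 𝓕_ac(0)` READABLE, `k` the door's exponent.
[cite: JetchevSkinnerWan2017, §3.4 (arXiv:1512.06894 pp. 14–15)] -/
theorem exists_dvd_pow_mul_unit_of_hasCharValuationAt {m : ℕ}
    (hval : AcSelmer.XAc.HasCharValuationAt E p κ₂ vbar ∅ γ₂ m)
    (hctl : ∃ n : ℕ, ∀ s : unrSelmer₂ κ₁ κ₂ (E.geomPrimaryTorsion p) vbar,
      conjSel₂ κ₁ κ₂ (E.geomPrimaryTorsion p) vbar γ₁ s = s →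
        p ^ n • s ∈ Set.range (E.selmerAcToUnrSelmer₂ p κ₁ κ₂ vbar))
    (J : ℤ_[p] →+* PadicComplexInt p) (C₀ : IwasawaAlgebra₂ p)
    (hC₀ : XGr₂.charIdeal E p κ₁ κ₂ vbar γ₁ γ₂ = Ideal.span {C₀}) :
    ∃ (k : ℕ) (u : PadicComplexInt p), IsUnit u ∧
      PowerSeries.constantCoeff (PowerSeries.constantCoeff (IwasawaAlgebra₂.toUnr₂ p J C₀)) ∣
        ((p : ℕ) : PadicComplexInt p) ^ (k + m) * u := by
  obtain ⟨k, F, -, hF0, hFm, -, hk0⟩ :=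
    constantCoeff_toUnr₂_dvd_of_hasCharValuationAt E p κ₁ κ₂ vbar γ₁ γ₂ hval hctl J C₀ hC₀
  refine ⟨k, J (PadicInt.unitCoeff hF0 : ℤ_[p]), (PadicInt.unitCoeff hF0).isUnit.map J, ?_⟩
  rw [PadicInt.unitCoeff_spec hF0, hFm, map_mul, map_pow, map_natCast, mul_left_comm, ← pow_add, mul_comm] at hk0
  exact hk0

end PrincipalCurve

section PrincipalRankOne

variable (W : WeierstrassCurve ℚ) [W.IsElliptic] [W.IsGloballyMinimal] (p : ℕ) [Fact p.Prime]
  {K : Type} [Field K] [NumberField K]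

/-- ★ **NONDEG₀(ℓ_ac) + BUDGET AT RANK-ONE DATA from the local finite exponent** (any `p`; the O2 line's currency
`ch_{Λ_K}(X_Gr₂(E_K/K̃_∞)) = (C₀)`): at LINK A₂'s rank-one data with `hfixc`, for every `J` and every generator `C₀`:
`π(J C₀) ≠ 0`, `(J C₀)(0,0) ≠ 0`, and `(J C₀)(0,0) ∣ p^{k+m} · u` for some door exponent `k`, the LINK A₂ exponent
`m = ord_p 𝓕_ac(0)` (`TwoAdicBDPAcControl.hasCharValuationAt_of_rankOne`) and a unit `u`.
[cite: JetchevSkinnerWan2017, Thm. 3.3.1 (shape) and §3.4] [cite: GreenbergLNM1716, §4 Lemma 4.2] -/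
theorem nondeg₀_and_budget_of_rankOne_of_localExponent (hK : IsImaginaryQuadratic K) (hsplit : X11b.SplitsIn K p)
    (κ₁ κ₂ : ZpExtension K p) (γ₁ γ₂ : absoluteGaloisGroup K) [Fact (ZpExtension.IsTopGeneratorPair κ₁ κ₂ γ₁ γ₂)]
    [Fact (κ₂.IsTopGenerator γ₂)] (hκ₂ : κ₂.IsAnticyclotomic)
    (vbar : HeightOneSpectrum (𝓞 K)) (hvbar : ((p : ℕ) : 𝓞 K) ∈ vbar.asIdeal)
    (hrank : (W.baseChange K).mordellWeilRank = 1)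
    (hsha : Finite (AddCommGroup.primaryComponent (W.baseChange K).sha p))
    (hfixc : ∃ c : ℕ, ∀ m : (W.baseChange K).geomPrimaryTorsion p, (∀ x : absoluteGaloisGroup K,
      x ∈ ZpExtension.pairKer κ₁ κ₂ → x ∈ inertia vbar → x • m = m) → p ^ c • m = 0)
    (J : ℤ_[p] →+* PadicComplexInt p) (C₀ : IwasawaAlgebra₂ p)
    (hC₀ : XGr₂.charIdeal (W.baseChange K) p κ₁ κ₂ vbar γ₁ γ₂ = Ideal.span {C₀}) :
    PowerSeries.constantCoeff (IwasawaAlgebra₂.toUnr₂ p J C₀) ≠ 0 ∧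
      PowerSeries.constantCoeff (PowerSeries.constantCoeff (IwasawaAlgebra₂.toUnr₂ p J C₀)) ≠ 0 ∧
      ∃ (m k : ℕ) (u : PadicComplexInt p), AcSelmer.XAc.HasCharValuationAt (W.baseChange K) p κ₂ vbar ∅ γ₂ m ∧
        IsUnit u ∧ PowerSeries.constantCoeff (PowerSeries.constantCoeff (IwasawaAlgebra₂.toUnr₂ p J C₀)) ∣
          ((p : ℕ) : PadicComplexInt p) ^ (k + m) * u := by
  haveI : (W.baseChange K).IsElliptic := by rw [baseChange]; infer_instance
  obtain ⟨m, hm⟩ := hasCharValuationAt_of_rankOne W p hK hsplit κ₂ hκ₂ γ₂ vbar hvbar hrank hsha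
  have hctl := acLineControl_of_localExponent W p K hK κ₁ κ₂ γ₁ γ₂ vbar hvbar hfixc
  obtain ⟨h1, h2⟩ := constantCoeff_toUnr₂_ne_zero_of_hasCharValuationAt (W.baseChange K) p κ₁ κ₂ vbar γ₁ γ₂ hm hctl J C₀ hC₀
  obtain ⟨k, u, hu, hdvd⟩ := exists_dvd_pow_mul_unit_of_hasCharValuationAt (W.baseChange K) p κ₁ κ₂ vbar γ₁ γ₂ hm hctl
    J C₀ hC₀
  exact ⟨h1, h2, m, k, u, hm, hu, hdvd⟩

end PrincipalRankOne

/-! ## §3. `p = 2`: the (e15) inequality «pinning needs Selmer budget at the origin», `1 + a ≤ k + m` -/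

section Inequality

/-- **Exponent comparison in a local domain.** If `ϖ ≠ 0`, `c ∈ 𝔪`, `u` is a unit and `ϖ^a · c ∣ ϖ^n · u`, then `a < n`:
otherwise `u = ϖ^{a−n} · c · d ∈ 𝔪`. [folklore] -/
theorem lt_of_pow_mul_dvd_pow_mul {R : Type*} [CommRing R] [IsDomain R] [IsLocalRing R] {ϖ c u : R} (hϖ : ϖ ≠ 0)
    (hc : c ∈ IsLocalRing.maximalIdeal R) (hu : IsUnit u) {a n : ℕ} (h : ϖ ^ a * c ∣ ϖ ^ n * u) : a < n := by
  by_contra hlt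
  have hle : n ≤ a := not_lt.mp hlt
  obtain ⟨d, hd⟩ := h
  have e : ϖ ^ n * u = ϖ ^ n * (ϖ ^ (a - n) * c * d) := by
    rw [hd, ← Nat.add_sub_of_le hle, pow_add, Nat.add_sub_cancel_left]
    ring
  have hu' : u = ϖ ^ (a - n) * c * d := mul_left_cancel₀ (pow_ne_zero n hϖ) e
  have hmem : u ∈ IsLocalRing.maximalIdeal R := by
    rw [hu']
    exact Ideal.mul_mem_right _ _ (Ideal.mul_mem_left _ _ hc)
  exact (IsLocalRing.mem_maximalIdeal u).mp hmem hu

variable (W : WeierstrassCurve ℚ) [W.IsElliptic] [W.IsGloballyMinimal]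
  {K : Type} [Field K] [NumberField K] (E : WeierstrassCurve K) [E.IsElliptic]
  (κ₁ κ₂ : ZpExtension K 2) (vbar : HeightOneSpectrum (𝓞 K)) (γ₁ γ₂ : absoluteGaloisGroup K)
  [Fact (ZpExtension.IsTopGeneratorPair κ₁ κ₂ γ₁ γ₂)] [Fact (κ₂.IsTopGenerator γ₂)]
  -- the pinning datum of the O2 line, UNFOLDED as in ACPIN-NEC (p781951): `FibrePinned G (toUnr₂ 2 J C₀)`, the W⁺ reading
  -- `G(0,0) ∈ 𝔪`, and a content decomposition `toUnr₂ 2 J C₀ = 2^a · C₁` with `red C₁ ≠ 0`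
  (J : ℤ_[2] →+* PadicComplexInt 2) (C₀ : IwasawaAlgebra₂ 2) (G : PowerSeries (PowerSeries (PadicComplexInt 2)))
  (hpin : ∃ 𝔓 : Ideal (PowerSeries (PowerSeries (IsLocalRing.ResidueField (PadicComplexInt 2)))),
    𝔓.IsPrime ∧ PowerSeries.map (PowerSeries.map (IsLocalRing.residue (PadicComplexInt 2))) G ∉ 𝔓 ∧
    ∀ (a : ℕ) (C₁ : PowerSeries (PowerSeries (PadicComplexInt 2))),
      IwasawaAlgebra₂.toUnr₂ 2 J C₀ = (2 : PowerSeries (PowerSeries (PadicComplexInt 2))) ^ a * C₁ →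
      PowerSeries.map (PowerSeries.map (IsLocalRing.residue (PadicComplexInt 2))) C₁ ≠ 0 →
      PowerSeries.map (PowerSeries.map (IsLocalRing.residue (PadicComplexInt 2))) C₁ ∈
        𝔓 ⊔ Ideal.span {PowerSeries.map (PowerSeries.map (IsLocalRing.residue (PadicComplexInt 2))) G})
  (hG0 : PowerSeries.constantCoeff (PowerSeries.constantCoeff G) ∈ IsLocalRing.maximalIdeal (PadicComplexInt 2))
  (a : ℕ) (C₁ : PowerSeries (PowerSeries (PadicComplexInt 2)))
  (hC : IwasawaAlgebra₂.toUnr₂ 2 J C₀ = (2 : PowerSeries (PowerSeries (PadicComplexInt 2))) ^ a * C₁)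
  (hC₁ : PowerSeries.map (PowerSeries.map (IsLocalRing.residue (PadicComplexInt 2))) C₁ ≠ 0)

include hpin hG0 hC hC₁

/-- ★ **(e15) «PINNING NEEDS SELMER BUDGET AT THE ORIGIN», `p = 2`.** Hypotheses: the O2 line's ACPIN datum predicate
`FibrePinned G (toUnr₂ 2 J C₀)` UNFOLDED (as in ACPIN-NEC p781951: some prime `𝔓` of `𝔽̄₂⟦T₁⟧⟦T₂⟧` with `red G ∉ 𝔓` and
`red C₁ ∈ 𝔓 + (red G)` for every primitive part `C₁`), the W⁺ reading `G(0,0) ∈ 𝔪_{𝒪_{ℂ₂}}`, a content decomposition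
`toUnr₂ 2 J C₀ = 2^a · C₁` with `red C₁ ≠ 0` (TwoContent₂, `TwoAdicBDPPrimePinning.exists_toUnr₂_eq_two_pow_mul_of_ne_zero`),
and a BUDGET `(J C₀)(0,0) ∣ 2^n · u` with `u` a unit. Then `a < n`: ACPIN-NEC gives `C₁(0,0) ∈ 𝔪`
(`constantCoeff_constantCoeff_mem_maximalIdeal_of_fibrePinned_two`), `(J C₀)(0,0) = 2^a · C₁(0,0)`, and
`lt_of_pow_mul_dvd_pow_mul`. With `n = k + m`: **`1 + a ≤ k + m`** — a pinned W⁺ datum with `k + m = 0` is IMPOSSIBLE. [folklore] -/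
theorem lt_budget_of_fibrePinned {n : ℕ} {u : PadicComplexInt 2} (hu : IsUnit u)
    (hbudget : PowerSeries.constantCoeff (PowerSeries.constantCoeff (IwasawaAlgebra₂.toUnr₂ 2 J C₀)) ∣
      (2 : PadicComplexInt 2) ^ n * u) :
    a < n := by
  have hc : PowerSeries.constantCoeff (PowerSeries.constantCoeff C₁) ∈ IsLocalRing.maximalIdeal (PadicComplexInt 2) :=
    constantCoeff_constantCoeff_mem_maximalIdeal_of_fibrePinned_two G _ hpin hG0 a C₁ hC hC₁
  rw [hC, map_mul, map_pow, map_mul, map_pow, map_ofNat, map_ofNat] at hbudget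
  exact lt_of_pow_mul_dvd_pow_mul two_ne_zero hc hu hbudget

/-- ★ **(e15) AT A DATUM, `m`-currency**: `E` elliptic over a number field `K`, a generator pair with the anticyclotomic
character in the second slot, the pinning datum as above, `HasCharValuationAt (E) 2 κ₂ v̄ ∅ γ₂ m` (LINK A₂'s exponent
`m = ord₂ 𝓕_ac(0)`), control with exponent, `ch_{Λ_K}(X_Gr₂) = (C₀)`: there are a door exponent `k` and a unit `u` with
`(J C₀)(0,0) ∣ 2^{k+m}·u` and **`1 + a ≤ k + m`**. [folklore] -/
theorem one_add_le_of_fibrePinned_of_hasCharValuationAt {m : ℕ}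
    (hval : AcSelmer.XAc.HasCharValuationAt E 2 κ₂ vbar ∅ γ₂ m)
    (hctl : ∃ n : ℕ, ∀ s : unrSelmer₂ κ₁ κ₂ (E.geomPrimaryTorsion 2) vbar,
      conjSel₂ κ₁ κ₂ (E.geomPrimaryTorsion 2) vbar γ₁ s = s →
        2 ^ n • s ∈ Set.range (E.selmerAcToUnrSelmer₂ 2 κ₁ κ₂ vbar))
    (hC₀ : XGr₂.charIdeal E 2 κ₁ κ₂ vbar γ₁ γ₂ = Ideal.span {C₀}) :
    ∃ (k : ℕ) (u : PadicComplexInt 2), IsUnit u ∧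
      PowerSeries.constantCoeff (PowerSeries.constantCoeff (IwasawaAlgebra₂.toUnr₂ 2 J C₀)) ∣
        (2 : PadicComplexInt 2) ^ (k + m) * u ∧ 1 + a ≤ k + m := by
  obtain ⟨k, u, hu, hdvd⟩ := exists_dvd_pow_mul_unit_of_hasCharValuationAt E 2 κ₁ κ₂ vbar γ₁ γ₂ hval hctl J C₀ hC₀
  rw [Nat.cast_ofNat] at hdvd
  refine ⟨k, u, hu, hdvd, ?_⟩
  have hlt := lt_budget_of_fibrePinned J C₀ G hpin hG0 a C₁ hC hC₁ hu hdvd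
  omega

/-- ★ **(e15) ON THE HABITAT'S RANK-ONE DATA, from the local finite exponent** (`p = 2`): the pinning datum as above for
`E_K = W.baseChange K`, LINK A₂'s binders (`W/ℚ` elliptic globally minimal, `K` imaginary quadratic with `2` split, a generator
pair with `κ₂` anticyclotomic, `v̄ ∋ 2`, `rank E(K) = 1`, `#Ш(E/K)[2^∞] < ∞`), `hfixc` at `v̄`, `ch_{Λ_K}(X_Gr₂(E_K/K̃_∞)) = (C₀)`:
there are the LINK A₂ exponent `m` (`HasCharValuationAt … m`), a door exponent `k` and a unit `u` with `(J C₀)(0,0) ∣ 2^{k+m}·u`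
and **`1 + a ≤ k + m`** (`m`, `a` instrument-readable; `k` the control/specialisation exponent). [folklore] -/
theorem one_add_le_of_fibrePinned_of_rankOne_of_localExponent (hK : IsImaginaryQuadratic K)
    (hsplit : X11b.SplitsIn K 2) (hκ₂ : κ₂.IsAnticyclotomic) (hvbar : ((2 : ℕ) : 𝓞 K) ∈ vbar.asIdeal)
    (hrank : (W.baseChange K).mordellWeilRank = 1)
    (hsha : Finite (AddCommGroup.primaryComponent (W.baseChange K).sha 2))
    (hfixc : ∃ c : ℕ, ∀ m : (W.baseChange K).geomPrimaryTorsion 2, (∀ x : absoluteGaloisGroup K,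
      x ∈ ZpExtension.pairKer κ₁ κ₂ → x ∈ inertia vbar → x • m = m) → 2 ^ c • m = 0)
    (hC₀ : XGr₂.charIdeal (W.baseChange K) 2 κ₁ κ₂ vbar γ₁ γ₂ = Ideal.span {C₀}) :
    ∃ (m k : ℕ) (u : PadicComplexInt 2), AcSelmer.XAc.HasCharValuationAt (W.baseChange K) 2 κ₂ vbar ∅ γ₂ m ∧
      IsUnit u ∧ PowerSeries.constantCoeff (PowerSeries.constantCoeff (IwasawaAlgebra₂.toUnr₂ 2 J C₀)) ∣
        (2 : PadicComplexInt 2) ^ (k + m) * u ∧ 1 + a ≤ k + m := by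
  haveI : (W.baseChange K).IsElliptic := by rw [baseChange]; infer_instance
  obtain ⟨m, hm⟩ := hasCharValuationAt_of_rankOne W 2 hK hsplit κ₂ hκ₂ γ₂ vbar hvbar hrank hsha
  have hctl := acLineControl_of_localExponent W 2 K hK κ₁ κ₂ γ₁ γ₂ vbar hvbar hfixc
  obtain ⟨k, u, hu, hdvd, hle⟩ := one_add_le_of_fibrePinned_of_hasCharValuationAt (W.baseChange K) κ₁ κ₂ vbar γ₁ γ₂
    J C₀ G hpin hG0 a C₁ hC hC₁ hm hctl hC₀
  exact ⟨m, k, u, hm, hu, hdvd, hle⟩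

end Inequality

end Summit.BirchSwinnertonDyer.BirchSwinnertonDyer.Theorems.TwoAdicBDPAcLineSpec

end
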